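import Literature.NumberTheory.EllipticCurves.Rank1Residual.Typed.X10ThreeDescentCertificate
import Literature.NumberTheory.EllipticCurves.Rank1Residual.ClassX1Isogeny
import Literature.NumberTheory.EllipticCurves.AnalyticRankOrderProofs
import HarnessLib

/-!
# Class X1 ∩ {r = 1} at p = 3, per curve: `BSD(E,3)` from Gross–Zagier–Kolyvagin and Cassels plus
# the ALGEBRAIC certificate `Ш(E′)[3] = 0` of an explicit 3-isogeny descent (prover B, gen 5)

HONEST FRAMING (BSD rank-≤1 residual cell `b2b-bsdres`, home `run/shared/lean/b2b/bsd-rank1-residual/`,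
unit `b2b-bsdres-x1b`, prover B = the independent patchwork, no Keller–Yin input; verbatim): the goal
is to DELETE the COMBINATION-SHAPED residual classes for ALL analytic-rank `≤ 1` curves over `ℚ` —
"full BSD formula for every rank `≤ 1` curve in class C" assembled STRICTLY from published theorems —
so that the rank-`≤ 1` remainder becomes exactly the CONSTRUCTION-SHAPED classes, which are TYPED
(missing-input `Prop`s), NOT attempted; this is not "finishing BSD".

Theorems only (no definition, no new named fact). The X1 instances of the class-free certificate
consumer `Typed.bsdp_of_shaAn_unit_of_noPTorsion` (x11b, `Typed/KolyvaginCertificate.lean`: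
`r_an ≤ 1`, `p ∤ #Ш_an`, `Ш(E/ℚ)[p] = 0` ⟹ `BSDp W p`, from Gross–Zagier–Kolyvagin alone), with the
certificate allowed on any `ℚ`-ISOGENOUS curve (Cassels' invariance of the BSD quotient; the class
hypothesis on the census curve only, `ClassX1.of_isIsogenous`, gen 5).

**Why (census of record v5, N < 2·10⁴).** The rank-one part of X1 at `p = 3` — 699 pairs, 672 of
parity type A (`X1a`: conditional on the Keller–Yin preprint on prover A's route; on prover B's route
"PUB modulo the per-curve Schneider certificate", gens 3–4) — admits a THIRD per-curve route with
NO `p`-adic input at all: Miller–Stoll's explicit `3`-isogeny descent. At 651 of the 699 pairs some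
curve `E` of the isogeny class has a rational point `T` of order `3`; the prover's complete explicit
descent (`HOME/b2b-bsdres-x1b/gen5/desc3rank1/`: both isogeny Selmer groups `Sel^{φ}(E) ⊂ H¹(ℚ, ℤ/3)`
and `Sel^{φ̂}(E′) ⊂ ℚ^×/ℚ^{×3}`, `E′ = E/⟨T⟩`, computed EXACTLY — local images by witnessed sampling made
exact by Schaefer's product formula, the character side by local Tate duality, the Mordell–Weil side
by an exact `3`-division-polynomial saturation test) finds at ALL 651 pairs
`Sel^{φ}(E) = E′(ℚ)/φE(ℚ)` and `Sel^{φ̂}(E′) = E(ℚ)/φ̂E′(ℚ)`, i.e. `Ш(E)[φ] = Ш(E′)[φ̂] = 0`, hence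
`Ш(E)[3] = Ш(E′)[3] = 0`; with `#Ш_an(E) = #Ш_an(E′) = 1` (Cremona) the theorems below give `BSD(E,3)`,
`BSD(E′,3)` and, by Cassels, `BSD` at the census curve — from the PUBLISHED Gross–Zagier–Kolyvagin and
Cassels theorems plus a finite algebraic certificate (lane to re-run with a second implementation,
e.g. Magma's `ThreeIsogenyDescent`, before any row changes). Per curve; NOT a class theorem; the
class statement X1 ∩ {r = 1} stays typed (`Typed/X1.lean`).

**This file proves** (binders: `hGZK` Gross–Zagier–Kolyvagin bsd.S17, `hmod` modularity (entire
continuation), `hCassels` Cassels 1965 / Milne ADT I.7.3 — all PUBLISHED named facts of the tree):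
* `X1.bsdp_of_noPTorsion` — canonical shape
  `W.analyticRank ≤ 1 → ClassX1 W p → p ∤ #Ш_an(W) → Ш(W/ℚ)[p] = 0 → BSDp W p`;
* `X1.bsdp_of_noPTorsion_of_isIsogenous` — the same with the certificate (`p ∤ #Ш_an`, `Ш[p] = 0`)
  on any `ℚ`-isogenous globally minimal `W′`;
* `X1.missingInputAt_of_noPTorsion` — the typed input `Typed.X1.MissingInputAt W p` HOLDS at such a
  pair (its rank-`1` conjunct `MissingPPartAt W p` by `Typed.missingPPartAt_of_shaAn_unit_of_noPTorsion`;
  its rank-`0` conjunct likewise, both valuations being `0`).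

References: Gross–Zagier 1986 / Kolyvagin 1990 (bsd.S17); Cassels 1965, Milne ADT I.7.3
[MilneADT2006]; Miller 2011 Def. 1.1 [Miller2011LMS]; Miller–Stoll, Math. Comp. 82 (2013) (explicit
isogeny descent); Schaefer, J. Number Theory 56 (1996) Lemma 3.8; Schaefer–Stoll, Trans. AMS 356
(2004); cell files `b2b-bsdres-x1b/X1-B.md` §10c, `gen5/desc3rank1/CERT-X1-RANK1-DESC3.md`.
-/

set_option autoImplicit false

noncomputable section

open scoped Classical

open WeierstrassCurve Literature.NumberTheory.EllipticCurves
  Literature.NumberTheory.EllipticCurves.Wuthrich2014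
  Literature.NumberTheory.EllipticCurves.Rank1Residual.Typed

namespace Literature.NumberTheory.EllipticCurves.Rank1Residual

/-- **X1, per curve, image-free and `p`-adic-free: `r_an ≤ 1 → ClassX1 W p → p ∤ #Ш_an →
Ш(E/ℚ)[p] = 0 → BSDp W p`.** Named fact: Gross–Zagier–Kolyvagin (`hGZK`). Computed per curve: the
lane's exact `#Ш_an` (`hq`, `hv`) and the finite certificate `h` (an explicit `p`-isogeny descent with
both isogeny Selmer groups equal to the Mordell–Weil images, or a full `p`-descent). The class
hypothesis is not used by the bookkeeping and is kept for the census shape. Per curve; NOT a class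
theorem. [cite: Miller2011LMS, §1 Def. 1.1] -/
theorem X1.bsdp_of_noPTorsion (hGZK : rank_eq_analyticRank_of_analyticRank_le_one)
    (W : WeierstrassCurve ℚ) [W.IsElliptic] [W.IsGloballyMinimal] (p : ℕ) [Fact p.Prime]
    (hr : W.analyticRank ≤ 1) (_hX : ClassX1 W p)
    {q : ℚ} (hq : shaAn W = (q : ℂ)) (hv : padicValRat p q = 0)
    (h : ∀ x : W.sha, (p : ℤ) • x = 0 → x = 0) : BSDp W p :=
  bsdp_of_shaAn_unit_of_noPTorsion W p hGZK hr hq hv h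

/-- **The typed input of `Typed/X1.lean` HOLDS at such a pair**: `r_an ≤ 1`, `p ∤ #Ш_an`,
`Ш(E/ℚ)[p] = 0` ⟹ `Typed.X1.MissingInputAt W p` (both conjuncts are weakenings of
`MissingPPartAt W p`, which holds with both valuations `0`). No class hypothesis needed.
[cite: Miller2011LMS, §1 Def. 1.1] -/
theorem X1.missingInputAt_of_noPTorsion (hGZK : rank_eq_analyticRank_of_analyticRank_le_one)
    (W : WeierstrassCurve ℚ) [W.IsElliptic] (p : ℕ) [Fact p.Prime]
    (hr : W.analyticRank ≤ 1) {q : ℚ} (hq : shaAn W = (q : ℂ)) (hv : padicValRat p q = 0)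
    (h : ∀ x : W.sha, (p : ℤ) • x = 0 → x = 0) : Typed.X1.MissingInputAt W p := by
  have hP : MissingPPartAt W p := missingPPartAt_of_shaAn_unit_of_noPTorsion W p (hGZK W hr).2 hq hv h
  exact ⟨fun _ => (lower_and_upper_of_missingPPartAt W p hP).1, fun _ => hP⟩

/-- **X1, per curve, the certificate on an ISOGENOUS curve.** For globally minimal `W ∼ W′` over `ℚ`,
a prime `p` with `ClassX1 W p` and `ord_{s=1} L(W,s) ≤ 1`: if `#Ш(W′/ℚ)_an` is a rational of
`p`-adic valuation `0` and `Ш(W′/ℚ)[p] = 0`, then `BSDp W p` — `BSD(W′,p)` by Gross–Zagier–Kolyvagin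
(`r_an(W′) = r_an(W) ≤ 1`, equal L-functions), transported by Cassels' isogeny invariance
(`hCassels`; the leading coefficient `L^{(r)}(W′,1)/r! ≠ 0` by modularity `hmod` and the definition
of the analytic rank). Census: the 651 rank-one X1 pairs at `p = 3` whose class has a rational
`3`-torsion point (certificate from the explicit `3`-isogeny descent on that curve `E` and
`E′ = E/⟨T⟩`). [cite: Miller2011LMS, §1 Def. 1.1] [cite: MilneADT2006, Thm. I.7.3 and Remark I.7.4] -/
theorem X1.bsdp_of_noPTorsion_of_isIsogenous (hGZK : rank_eq_analyticRank_of_analyticRank_le_one)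
    (hmod : hasEntireLFunction_rat) (hCassels : bsdRHS_eq_of_isIsogenous)
    (W W' : WeierstrassCurve ℚ) [W.IsElliptic] [W'.IsElliptic] [W.IsGloballyMinimal]
    [W'.IsGloballyMinimal] (hiso : IsIsogenous W W') (p : ℕ) [Fact p.Prime]
    (hr : W.analyticRank ≤ 1) (_hX : ClassX1 W p)
    {q' : ℚ} (hq' : shaAn W' = (q' : ℂ)) (hv' : padicValRat p q' = 0)
    (h' : ∀ x : W'.sha, (p : ℤ) • x = 0 → x = 0) : BSDp W p := by
  have hr' : W'.analyticRank ≤ 1 := by rwa [← analyticRank_eq_of_isIsogenous' hiso]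
  have hB' : BSDp W' p := bsdp_of_shaAn_unit_of_noPTorsion W' p hGZK hr' hq' hv' h'
  obtain ⟨-, hfin'⟩ := hGZK W' hr'
  have hlead' : W'.leadingLCoeff ≠ 0 := WeierstrassCurve.leadingLCoeff_ne_zero_holds (hmod W')
  exact bsdp_of_isIsogenous hCassels hiso hfin' hlead' hB'

end Literature.NumberTheory.EllipticCurves.Rank1Residual

end
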